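import Summits.BirchSwinnertonDyer.Rank1Residual.GaloisImage.MazurTatePullbackComponents
import HarnessLib

/-!
# The pull-backs of `θ̃_f(n_d)` form an Euler-factor family generated from one primitive datum
# (hypothesis `hY` of PK-4b-C3 for the Mazur–Tate side)
# (cell `b2b-bsdres`, team n1011, ROUTE-1 PORT anatomy (P-KIM); R1-71/R1-72: PK-4b
# `KatoZetaValueDerivativeCongruence`, layer PK-4b-C4b-1; seat p15 GEN 9)

HONEST FRAMING (cell `b2b-bsdres`, run/shared/lean/b2b/bsd-rank1-residual/, verbatim in every
file): the goal of the cell is to DELETE the COMBINATION-SHAPED residual classes of the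
Birch–Swinnerton-Dyer formula for ALL analytic-rank `≤ 1` elliptic curves over `ℚ` — "full BSD
formula for every rank `≤ 1` curve in class `C`" assembled STRICTLY from published theorems — so
that the rank-`≤ 1` remainder becomes exactly the CONSTRUCTION-SHAPED classes, which are TYPED
(missing-input `Prop`s), NOT attempted. This is not "finishing BSD". Team n1011 (N10/N11; ROUTE 1,
the PORT anatomy (P-KIM) of class X4 ∧ `p = 3`): research route on CONSTRUCTION-SHAPED classes;
prove what is provable now; no claim beyond stated classes; census output = EVIDENCE, never a
Literature fact; RESIDUAL-MAP marks UNCHANGED; nothing is booked by this file. TOOL THEOREMS ONLY: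
no definition, no named fact, no instance, no `sorry`.

## What

`n = ∏_i ℓ_i` distinct primes `∤ N`, `G = (ℤ/n)ˣ`, `f` with `IsNewform0 f`, `coeffField f = ⊥`,
`a_i = a_{ℓ_i}(f) ∈ ℤ`. With `N_j` the norm element of `K_j = ker((ℤ/n)ˣ → (ℤ/(n/ℓ_j))ˣ)`,
`e_j = (ℓ_j − 1)⁻¹ N_j`, `M_j = a_j − δ_{λ_j} − δ_{λ_j⁻¹}` (`λ_j ↦ ℓ_j` under the reduction mod `n/ℓ_j`)
and the pull-backs `Θ_d = Σ_g [π_d(g)/n_d]⁺_f δ_g ∈ ℂ[G]` of `θ̃_f(n_d)`, there is ONE `Θ̂ ∈ ℂ[G]` —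
its character components are the primitive Birch sums `Σ_{b∈(ℤ/n₀)ˣ} [b/n₀]⁺ ψ₀(b)`, `n₀ = cond ψ`,
`ψ₀` the primitive character of `ψ` — with, for EVERY `d`,
`Θ_d = (∏_{j∉d} N_j) · (∏_{i∈d} (e_i M_i + (1 − e_i))) · Θ̂`            (`exists_pullback_eq_family`):
both sides have the same character components (PK-4b-C4a: pull-back components, F-C iterated down to
the conductor; C1: Fourier injectivity). This is the hypothesis `hY` of PK-4b-C3
`prod_deriv_mul_sub_eq_sum_of_generated` for the modular side, up to the common commuting factors
`κ · δ_{u⁻¹} · E · C⁻ · (1 + δ_{−1})` which multiply `Θ_d` and `Θ̂` alike.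
HONEST LIMITS: bookkeeping over ℂ; no Kato object; closes nothing.

References: B. Mazur, J. Tate, Duke Math. J. 54 (1987) §1; K. Ota, arXiv:1509.00682 Prop. 2.3;
r1 ROUTE-1 §55–57 (cells/n1011/ROUTE-1.md).
-/

noncomputable section

namespace Summit.BirchSwinnertonDyer.Rank1Residual.GaloisImage

namespace EulerFactorComparison

open Finset MonoidAlgebra
open scoped BigOperators
open Literature.NumberTheory.EllipticCurves Literature.NumberTheory.EllipticCurves.ModularForms
open CongruenceSubgroup

variable {ι : Type*} [Fintype ι] [DecidableEq ι] (ℓ : ι → ℕ) [hℓ : ∀ i, Fact (ℓ i).Prime]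
  (hinj : Function.Injective ℓ) {n : ℕ} [NeZero n] (hn : ∏ i, ℓ i = n)

/-! ### §1 More level arithmetic -/

omit [Fintype ι] in
include hinj in
/-- A product of distinct primes each dividing `c` divides `c`. [folklore] -/
theorem prod_dvd_of_forall_dvd {c : ℕ} (S : Finset ι) (h : ∀ i ∈ S, ℓ i ∣ c) : (∏ i ∈ S, ℓ i) ∣ c := by
  induction S using Finset.induction_on with
  | empty => simp
  | insert j S hj ih =>
    rw [Finset.prod_insert hj]
    refine Nat.Coprime.mul_dvd_of_dvd_of_dvd ?_ (h j (Finset.mem_insert_self j S))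
      (ih fun i hi => h i (Finset.mem_insert_of_mem hi))
    exact Nat.Coprime.prod_right fun i hi =>
      (Nat.coprime_primes (hℓ j).out (hℓ i).out).mpr fun e => hj (hinj e ▸ hi)

omit [Fintype ι] in
include hinj in
/-- A divisor `c` of `n_d` is the product of the `ℓ_i`, `i ∈ d`, dividing it:
`c ∣ ∏_{i∈d} ℓ_i ⇒ c = ∏_{i∈d, ℓ_i ∣ c} ℓ_i`. [folklore] -/
theorem eq_prod_filter_of_dvd_prod {c : ℕ} {d : Finset ι} (hc : c ∣ ∏ i ∈ d, ℓ i) :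
    c = ∏ i ∈ d.filter (fun i => ℓ i ∣ c), ℓ i := by
  refine Nat.dvd_antisymm ?_ (prod_dvd_of_forall_dvd ℓ hinj _ fun i hi => (Finset.mem_filter.mp hi).2)
  rw [← Finset.prod_filter_mul_prod_filter_not d (fun i => ℓ i ∣ c)] at hc
  refine Nat.Coprime.dvd_of_dvd_mul_right ?_ hc
  exact Nat.Coprime.prod_right fun i hi =>
    ((Nat.Prime.coprime_iff_not_dvd (hℓ i).out).mpr (Finset.mem_filter.mp hi).2).symm

omit [Fintype ι] [DecidableEq ι] hℓ in
/-- `n_d = c · ∏_{i∈d, ℓ_i∤c} ℓ_i` when `c = ∏_{i∈d, ℓ_i∣c} ℓ_i`. [folklore] -/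
theorem prod_eq_mul_prod_filter_not {c : ℕ} {d : Finset ι} (hc : c = ∏ i ∈ d.filter (fun i => ℓ i ∣ c), ℓ i) :
    ∏ i ∈ d, ℓ i = c * ∏ i ∈ d.filter (fun i => ¬ ℓ i ∣ c), ℓ i := by
  calc ∏ i ∈ d, ℓ i = (∏ i ∈ d.filter (fun i => ℓ i ∣ c), ℓ i) * ∏ i ∈ d.filter (fun i => ¬ ℓ i ∣ c), ℓ i :=
        (Finset.prod_filter_mul_prod_filter_not d (fun i => ℓ i ∣ c) _).symm
    _ = c * ∏ i ∈ d.filter (fun i => ¬ ℓ i ∣ c), ℓ i := by rw [← hc]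

omit [DecidableEq ι] in
/-- `univ ∖ (univ ∖ {j}) = {j}`: the complement of `n/ℓ_j`'s support. [folklore] -/
theorem univ_sdiff_erase (j : ι) [DecidableEq ι] : (univ : Finset ι) \ univ.erase j = {j} := by
  ext i
  simp [Finset.mem_sdiff, Finset.mem_erase]

/-! ### §2 F-C iterated, with the hypotheses only on the primes that are used -/

section Hecke

variable {N : ℕ} [NeZero N] (f : CuspForm (Gamma0 N) 2)

omit [Fintype ι] hℓ in
include hinj in
/-- `sum_units_changeLevel_mul_ratPlusSymbol_prod` with `ℓ_i ∤ N`, `ℓ_i ∤ m₀`, `a_i = a_{ℓ_i}` assumed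
only for `i ∈ T`. [cite: Ota2018, Prop. 2.3 (1)] -/
theorem sum_units_changeLevel_mul_ratPlusSymbol_prod' [hℓ : ∀ i, Fact (ℓ i).Prime] (hf : IsNewform0 f)
    (hQ : coeffField f = ⊥) (T : Finset ι) (hℓN : ∀ i ∈ T, ¬ ℓ i ∣ N) (a : ι → ℤ)
    (ha : ∀ i ∈ T, cuspCoeff f (ℓ i) = a i) {m₀ : ℕ} [NeZero m₀] (hm₀ : ∀ i ∈ T, ¬ ℓ i ∣ m₀)
    (χ₀ : DirichletCharacter ℂ m₀) {m : ℕ} [NeZero m] (hm : m = m₀ * ∏ i ∈ T, ℓ i) (hdvd : m₀ ∣ m) :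
    ∑ b : (ZMod m)ˣ, algebraMap ℚ ℂ (ratPlusSymbol f (((b : ZMod m).val : ℚ) / m)) *
        DirichletCharacter.changeLevel hdvd χ₀ (b : ZMod m) =
      (∏ i ∈ T, (algebraMap ℚ ℂ (a i) - χ₀ (ℓ i : ZMod m₀) - χ₀⁻¹ (ℓ i : ZMod m₀))) *
        ∑ b : (ZMod m₀)ˣ, algebraMap ℚ ℂ (ratPlusSymbol f (((b : ZMod m₀).val : ℚ) / m₀)) *
          χ₀ (b : ZMod m₀) := by
  -- restrict the prime family to the subtype `T`
  have hm' : m = m₀ * ∏ x : ↥T, ℓ (x : ι) := by rw [hm, ← Finset.prod_coe_sort T]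
  haveI : ∀ x : ↥T, Fact (ℓ (x : ι)).Prime := fun x => hℓ x
  have h := sum_units_changeLevel_mul_ratPlusSymbol_prod f hf hQ (fun x : ↥T => ℓ (x : ι))
    (fun x y hxy => Subtype.ext (hinj hxy)) (fun x => hℓN x x.2) (fun x => a x) (fun x => ha x x.2)
    (fun x => hm₀ x x.2) χ₀ univ hm' hdvd
  rw [h, ← Finset.prod_coe_sort T]

end Hecke

/-! ### §3 Character components of the local factors and of the norm prefactor -/

section Components

omit [DecidableEq ι] in
include hinj hn in
/-- `lift ψ N_j = ℓ_j − 1` or `0` according as `cond ψ ∣ n/ℓ_j`. [folklore] -/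
theorem lift_norm_erase_eq [DecidableEq ι] (j : ι) (ψ : DirichletCharacter ℂ n) :
    haveI : NeZero (∏ i ∈ univ.erase j, ℓ i) := ⟨Finset.prod_ne_zero_iff.mpr fun i _ => (hℓ i).out.ne_zero⟩
    MonoidAlgebra.lift ℂ ℂ (ZMod n)ˣ ((Units.coeHom ℂ).comp ψ.toUnitHom)
        (∑ h ∈ univ.filter (· ∈ (ZMod.unitsMap (prod_dvd_of_prod_eq ℓ hn (univ.erase j))).ker),
          single h (1 : ℂ)) =
      if ψ.conductor ∣ ∏ i ∈ univ.erase j, ℓ i then (((ℓ j - 1 : ℕ)) : ℂ) else 0 := by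
  haveI : NeZero (∏ i ∈ univ.erase j, ℓ i) := ⟨Finset.prod_ne_zero_iff.mpr fun i _ => (hℓ i).out.ne_zero⟩
  rw [lift_sum_single_ker_eq (prod_dvd_of_prod_eq ℓ hn (univ.erase j)) ψ,
    card_ker_unitsMap_prod ℓ hinj hn (univ.erase j), univ_sdiff_erase, Finset.prod_singleton]

omit [Fintype ι] [DecidableEq ι] hℓ [NeZero n] in
/-- `lift ψ (e M + (1 − e)) = M(ψ)` if `lift ψ e = 1`, `= 1` if `lift ψ e = 0`. [folklore] -/
theorem lift_localFactor_eq (φ : (ZMod n)ˣ →* ℂ) (e M : MonoidAlgebra ℂ (ZMod n)ˣ) (t : Prop) [Decidable t]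
    (he : MonoidAlgebra.lift ℂ ℂ (ZMod n)ˣ φ e = if t then 1 else 0) :
    MonoidAlgebra.lift ℂ ℂ (ZMod n)ˣ φ (e * M + (1 - e)) =
      if t then MonoidAlgebra.lift ℂ ℂ (ZMod n)ˣ φ M else 1 := by
  rw [map_add, map_mul, map_sub, map_one, he]
  split_ifs <;> ring

omit hℓ [NeZero n] in
include hn in
/-- The value `ψ(λ_j)` for `ψ` of conductor `n₀ ∣ n/ℓ_j` and `λ_j ↦ ℓ_j` under reduction mod `n/ℓ_j`:
`ψ(λ_j) = ψ₀(ℓ_j)`, `ψ₀` the primitive character of `ψ`. [folklore] -/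
theorem apply_lift_eq_primitiveCharacter (j : ι) (ψ : DirichletCharacter ℂ n)
    (hψ : ψ.conductor ∣ ∏ i ∈ univ.erase j, ℓ i) (lam : (ZMod n)ˣ)
    (hlam : ((ZMod.unitsMap (prod_dvd_of_prod_eq ℓ hn (univ.erase j)) lam : (ZMod (∏ i ∈ univ.erase j, ℓ i))ˣ) :
      ZMod (∏ i ∈ univ.erase j, ℓ i)) = (ℓ j : ZMod (∏ i ∈ univ.erase j, ℓ i))) :
    ψ (lam : ZMod n) = ψ.primitiveCharacter (ℓ j : ZMod ψ.conductor) := by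
  conv_lhs => rw [← DirichletCharacter.changeLevel_primitiveCharacter ψ]
  rw [DirichletCharacter.changeLevel_eq_cast_of_dvd _ _ lam]
  congr 1
  -- the cast of `lam` to `ZMod n₀` factors through `ZMod (n/ℓ_j)`, where `lam ≡ ℓ_j`
  have h1 : ((lam : ZMod n).cast : ZMod ψ.conductor) =
      ((((lam : ZMod n).cast : ZMod (∏ i ∈ univ.erase j, ℓ i))).cast : ZMod ψ.conductor) := by
    have := congrArg (fun φ : ZMod n →+* ZMod ψ.conductor => φ (lam : ZMod n))
      (ZMod.castHom_comp hψ (prod_dvd_of_prod_eq ℓ hn (univ.erase j))).symm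
    simpa only [RingHom.comp_apply, ZMod.castHom_apply] using this
  have h2 : (((lam : ZMod n).cast : ZMod (∏ i ∈ univ.erase j, ℓ i))) =
      (ℓ j : ZMod (∏ i ∈ univ.erase j, ℓ i)) := by
    rw [← hlam, ZMod.unitsMap_def, Units.coe_map, MonoidHom.coe_coe, ZMod.castHom_apply]
  rw [h1, h2, ZMod.cast_natCast hψ]

omit hℓ [NeZero n] in
include hn in
/-- Likewise `ψ(λ_j⁻¹) = ψ₀⁻¹(ℓ_j)`. [folklore] -/
theorem apply_lift_inv_eq_primitiveCharacter (j : ι) (ψ : DirichletCharacter ℂ n)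
    (hψ : ψ.conductor ∣ ∏ i ∈ univ.erase j, ℓ i) (lam : (ZMod n)ˣ)
    (hlam : ((ZMod.unitsMap (prod_dvd_of_prod_eq ℓ hn (univ.erase j)) lam : (ZMod (∏ i ∈ univ.erase j, ℓ i))ˣ) :
      ZMod (∏ i ∈ univ.erase j, ℓ i)) = (ℓ j : ZMod (∏ i ∈ univ.erase j, ℓ i))) :
    ψ ((lam⁻¹ : (ZMod n)ˣ) : ZMod n) = (ψ.primitiveCharacter)⁻¹ (ℓ j : ZMod ψ.conductor) := by
  rw [CharComponent.apply_coe_inv_eq_inv_apply ψ lam]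
  -- `ψ⁻¹ = changeLevel ψ₀⁻¹`
  have hψinv : ψ⁻¹ = DirichletCharacter.changeLevel ψ.conductor_dvd_level (ψ.primitiveCharacter)⁻¹ := by
    rw [map_inv, DirichletCharacter.changeLevel_primitiveCharacter]
  rw [hψinv, DirichletCharacter.changeLevel_eq_cast_of_dvd _ _ lam]
  congr 1
  have h1 : ((lam : ZMod n).cast : ZMod ψ.conductor) =
      ((((lam : ZMod n).cast : ZMod (∏ i ∈ univ.erase j, ℓ i))).cast : ZMod ψ.conductor) := by
    have := congrArg (fun φ : ZMod n →+* ZMod ψ.conductor => φ (lam : ZMod n))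
      (ZMod.castHom_comp hψ (prod_dvd_of_prod_eq ℓ hn (univ.erase j))).symm
    simpa only [RingHom.comp_apply, ZMod.castHom_apply] using this
  have h2 : (((lam : ZMod n).cast : ZMod (∏ i ∈ univ.erase j, ℓ i))) =
      (ℓ j : ZMod (∏ i ∈ univ.erase j, ℓ i)) := by
    rw [← hlam, ZMod.unitsMap_def, Units.coe_map, MonoidHom.coe_coe, ZMod.castHom_apply]
  rw [h1, h2, ZMod.cast_natCast hψ]

end Components

/-! ### §4 The pull-backs are a generated family -/

section Family

variable {N : ℕ} [NeZero N] (f : CuspForm (Gamma0 N) 2)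

include hinj hn in
/-- **The pull-backs of `θ̃_f(n_d)` are generated from the primitive Birch sums with the Mazur–Tate
local factors.** There is `Θ̂ ∈ ℂ[(ℤ/n)ˣ]` with
`Σ_g [π_d(g)/n_d]⁺ δ_g = (∏_{j∉d} N_j)(∏_{i∈d}(e_i M_i + (1 − e_i))) Θ̂` for every `d`, where
`e_j = (ℓ_j−1)⁻¹ N_j`, `M_j = a_j − δ_{λ_j} − δ_{λ_j⁻¹}`. [cite: Ota2018, Prop. 2.3 (1)] -/
theorem exists_pullback_eq_family (hf : IsNewform0 f) (hQ : coeffField f = ⊥) (hℓN : ∀ i, ¬ ℓ i ∣ N)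
    (a : ι → ℤ) (ha : ∀ i, cuspCoeff f (ℓ i) = a i) (lam : ι → (ZMod n)ˣ)
    (hlam : ∀ j, ((ZMod.unitsMap (prod_dvd_of_prod_eq ℓ hn (univ.erase j)) (lam j) :
      (ZMod (∏ i ∈ univ.erase j, ℓ i))ˣ) : ZMod (∏ i ∈ univ.erase j, ℓ i)) =
        (ℓ j : ZMod (∏ i ∈ univ.erase j, ℓ i)))
    (Nn e M : ι → MonoidAlgebra ℂ (ZMod n)ˣ)
    (hN : ∀ j, Nn j = ∑ h ∈ univ.filter (· ∈ (ZMod.unitsMap (prod_dvd_of_prod_eq ℓ hn (univ.erase j))).ker),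
      single h (1 : ℂ))
    (he : ∀ j, e j = (((ℓ j - 1 : ℕ) : ℂ))⁻¹ • Nn j)
    (hM : ∀ j, M j = algebraMap ℂ (MonoidAlgebra ℂ (ZMod n)ˣ) ((a j : ℤ) : ℂ) - single (lam j) 1 -
      single (lam j)⁻¹ 1) :
    ∃ Θ : MonoidAlgebra ℂ (ZMod n)ˣ, ∀ d : Finset ι,
      haveI : NeZero (∏ i ∈ d, ℓ i) := ⟨Finset.prod_ne_zero_iff.mpr fun i _ => (hℓ i).out.ne_zero⟩
      (∑ g : (ZMod n)ˣ, single g (algebraMap ℚ ℂ (ratPlusSymbol f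
          ((((ZMod.unitsMap (prod_dvd_of_prod_eq ℓ hn d) g : (ZMod (∏ i ∈ d, ℓ i))ˣ) :
            ZMod (∏ i ∈ d, ℓ i)).val : ℚ) / (∏ i ∈ d, ℓ i : ℕ))))) =
        (∏ j ∈ univ \ d, Nn j) * (∏ i ∈ d, (e i * M i + (1 - e i))) * Θ := by
  classical
  -- the primitive datum: components = primitive Birch sums
  obtain ⟨Θ, hΘ⟩ := exists_forall_lift_eq n (fun ψ =>
    haveI : NeZero ψ.conductor := ⟨ψ.conductor_ne_zero⟩
    ∑ b : (ZMod ψ.conductor)ˣ, algebraMap ℚ ℂ (ratPlusSymbol f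
      (((b : ZMod ψ.conductor).val : ℚ) / ψ.conductor)) * ψ.primitiveCharacter (b : ZMod ψ.conductor))
  refine ⟨Θ, fun d => ?_⟩
  haveI hnd : NeZero (∏ i ∈ d, ℓ i) := ⟨Finset.prod_ne_zero_iff.mpr fun i _ => (hℓ i).out.ne_zero⟩
  rw [← sub_eq_zero]
  refine eq_zero_of_forall_lift_eq_zero n _ fun ψ => ?_
  haveI : NeZero ψ.conductor := ⟨ψ.conductor_ne_zero⟩
  rw [map_sub, sub_eq_zero, map_mul, map_mul, map_prod, map_prod, hΘ ψ]
  -- components of the norm prefactor and of the local factors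
  have hNψ : ∀ j, MonoidAlgebra.lift ℂ ℂ (ZMod n)ˣ ((Units.coeHom ℂ).comp ψ.toUnitHom) (Nn j) =
      if ψ.conductor ∣ ∏ i ∈ univ.erase j, ℓ i then (((ℓ j - 1 : ℕ)) : ℂ) else 0 := fun j => by
    rw [hN j]; exact lift_norm_erase_eq ℓ hinj hn j ψ
  have hℓ1 : ∀ j, (((ℓ j - 1 : ℕ)) : ℂ) ≠ 0 := fun j => by
    exact_mod_cast (Nat.sub_pos_of_lt (hℓ j).out.one_lt).ne'
  have heψ : ∀ j, MonoidAlgebra.lift ℂ ℂ (ZMod n)ˣ ((Units.coeHom ℂ).comp ψ.toUnitHom) (e j) =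
      if ¬ ℓ j ∣ ψ.conductor then 1 else 0 := fun j => by
    rw [he j, map_smul, hNψ j, smul_eq_mul]
    by_cases h : ψ.conductor ∣ ∏ i ∈ univ.erase j, ℓ i
    · rw [if_pos h, if_pos ((dvd_prod_erase_iff_not_dvd ℓ hinj hn ψ.conductor_dvd_level j).mp h),
        inv_mul_cancel₀ (hℓ1 j)]
    · rw [if_neg h, if_neg (fun h' => h ((dvd_prod_erase_iff_not_dvd ℓ hinj hn ψ.conductor_dvd_level j).mpr h')),
        mul_zero]
  have hMψ : ∀ j, ¬ ℓ j ∣ ψ.conductor →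
      MonoidAlgebra.lift ℂ ℂ (ZMod n)ˣ ((Units.coeHom ℂ).comp ψ.toUnitHom) (M j) =
        algebraMap ℚ ℂ (a j) - ψ.primitiveCharacter (ℓ j : ZMod ψ.conductor) -
          (ψ.primitiveCharacter)⁻¹ (ℓ j : ZMod ψ.conductor) := fun j hj => by
    have hψj : ψ.conductor ∣ ∏ i ∈ univ.erase j, ℓ i :=
      (dvd_prod_erase_iff_not_dvd ℓ hinj hn ψ.conductor_dvd_level j).mpr hj
    rw [hM j, map_sub, map_sub, AlgHom.commutes, lift_single_coeHom, lift_single_coeHom, one_mul, one_mul,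
      apply_lift_eq_primitiveCharacter ℓ hn j ψ hψj (lam j) (hlam j),
      apply_lift_inv_eq_primitiveCharacter ℓ hn j ψ hψj (lam j) (hlam j)]
    simp only [eq_ratCast, Rat.cast_intCast, Algebra.algebraMap_self_apply]
  have hfac : ∀ i, MonoidAlgebra.lift ℂ ℂ (ZMod n)ˣ ((Units.coeHom ℂ).comp ψ.toUnitHom)
      (e i * M i + (1 - e i)) =
      if ¬ ℓ i ∣ ψ.conductor then
        algebraMap ℚ ℂ (a i) - ψ.primitiveCharacter (ℓ i : ZMod ψ.conductor) -
          (ψ.primitiveCharacter)⁻¹ (ℓ i : ZMod ψ.conductor) else 1 := fun i => by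
    rw [lift_localFactor_eq _ (e i) (M i) (¬ ℓ i ∣ ψ.conductor) (heψ i)]
    by_cases h : ¬ ℓ i ∣ ψ.conductor
    · rw [if_pos h, if_pos h, hMψ i h]
    · rw [if_neg h, if_neg h]
  simp_rw [hNψ, hfac]
  rw [← Finset.prod_filter]
  by_cases hcond : ψ.conductor ∣ ∏ i ∈ d, ℓ i
  · -- all `j ∉ d` satisfy `cond ∣ n/ℓ_j`
    have hall : ∏ j ∈ univ \ d, (if ψ.conductor ∣ ∏ i ∈ univ.erase j, ℓ i then (((ℓ j - 1 : ℕ)) : ℂ) else 0) =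
        ∏ j ∈ univ \ d, (((ℓ j - 1 : ℕ)) : ℂ) := by
      refine Finset.prod_congr rfl fun j hj => if_pos ?_
      exact (dvd_prod_iff_forall_dvd_prod_erase ℓ hinj hn ψ.conductor_dvd_level d).mp hcond j
        (Finset.mem_sdiff.mp hj).2
    rw [hall]
    -- the left side: `ψ` factors through `n_d`
    obtain ⟨hdvd, ψd, hψd⟩ := (DirichletCharacter.mem_conductorSet_iff_conductor_dvd ψ
      (prod_dvd_of_prod_eq ℓ hn d)).mpr hcond
    have hψd' : ψd = DirichletCharacter.changeLevel hcond ψ.primitiveCharacter := by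
      apply DirichletCharacter.changeLevel_injective (prod_dvd_of_prod_eq ℓ hn d)
      rw [← hψd, ← DirichletCharacter.changeLevel_trans, DirichletCharacter.changeLevel_primitiveCharacter]
    conv_lhs => rw [hψd]
    rw [lift_sum_single_comp_unitsMap_of_changeLevel (prod_dvd_of_prod_eq ℓ hn d)
      (fun h => algebraMap ℚ ℂ (ratPlusSymbol f ((((h : (ZMod (∏ i ∈ d, ℓ i))ˣ) : ZMod (∏ i ∈ d, ℓ i)).val : ℚ) /
        (∏ i ∈ d, ℓ i : ℕ)))) ψd,
      card_ker_unitsMap_prod ℓ hinj hn d, hψd']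
    -- F-C iterated from the conductor
    have hT : (∏ i ∈ d, ℓ i) = ψ.conductor * ∏ i ∈ d.filter (fun i => ¬ ℓ i ∣ ψ.conductor), ℓ i :=
      prod_eq_mul_prod_filter_not ℓ (eq_prod_filter_of_dvd_prod ℓ hinj hcond)
    rw [sum_units_changeLevel_mul_ratPlusSymbol_prod' ℓ hinj f hf hQ (d.filter (fun i => ¬ ℓ i ∣ ψ.conductor))
      (fun i _ => hℓN i) a (fun i _ => ha i) (fun i hi => (Finset.mem_filter.mp hi).2)
      ψ.primitiveCharacter hT hcond]
    push_cast
    ring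
  · -- both sides vanish
    have hex : ∃ j ∈ univ \ d, ¬ ψ.conductor ∣ ∏ i ∈ univ.erase j, ℓ i := by
      by_contra hno
      push Not at hno
      exact hcond ((dvd_prod_iff_forall_dvd_prod_erase ℓ hinj hn ψ.conductor_dvd_level d).mpr
        fun j hj => hno j (Finset.mem_sdiff.mpr ⟨Finset.mem_univ j, hj⟩))
    obtain ⟨j, hj, hjn⟩ := hex
    rw [lift_sum_single_comp_unitsMap_eq_zero (prod_dvd_of_prod_eq ℓ hn d)
      (fun h => algebraMap ℚ ℂ (ratPlusSymbol f ((((h : (ZMod (∏ i ∈ d, ℓ i))ˣ) : ZMod (∏ i ∈ d, ℓ i)).val : ℚ) /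
        (∏ i ∈ d, ℓ i : ℕ)))) ψ hcond,
      Finset.prod_eq_zero hj (if_neg hjn), zero_mul, zero_mul]

end Family

end EulerFactorComparison

end Summit.BirchSwinnertonDyer.Rank1Residual.GaloisImage

end
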